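import Literature.Computability.QuantumComplexity.StabilizerSimulationGadgetProofs
import Literature.Computability.QuantumComplexity.StabilizerSimulationMagicT
import Literature.Computability.QuantumComplexity.StabilizerRankLowerBounds
import Mathlib.LinearAlgebra.Basis.VectorSpace
import Mathlib.InformationTheory.Hamming
import HarnessLib

/-!
# Proof of the Peleg–Shpilka–Volk linear lower bound `χ(|T⟩^{⊗n}) = Ω(n)`

Topic `Literature/Computability/QuantumComplexity`. This file DISCHARGES the named fact
`PelegShpilkaVolk2022_stabilizerRank_magicT_linear` of `StabilizerRankLowerBounds.lean`
(Peleg–Shpilka–Volk, *Lower bounds on stabilizer rank*, Quantum 6 (2022) 652 = arXiv:2106.03214,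
Thm. 1.1 = Thm. 3.2): `theorem PelegShpilkaVolk2022_stabilizerRank_magicT_linear_holds`, with the
explicit constants `c = 1/100`, `n₀ = 0`, over the tree's operational `stabilizerStates` /
`stabilizerRank` (`StabilizerRank.lean`). The printed proof is followed step by step; everything
auxiliary lives in the sub-namespace `PelegShpilkaVolk` (it names the paper).

## Contents

1. **Bits.** `BVec n = Fin n → ZMod 2`; the phases `sgnZ a = (-1)^a`, `iPowZ a = i^a` of a bit and
   the parity identity `i^{[a ⊕ b]} = i^{[a]} i^{[b]} (-1)^{[a][b]}` (`iPowZ_add`); transport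
   `toQ / toB / flat` between the tree's Boolean registers `QReg n` and `𝔽₂ⁿ`, and the pointwise
   action of the Clifford generators read off the Pauli forms of
   `StabilizerSimulationGadgetProofs.lean`: `(S_j ψ)(v) = i^{v_j} ψ(v)`,
   `(H_j ψ)(v) = (ψ(v + e_j) + (-1)^{v_j} ψ(v))/√2`, `(CNOT_{i→j} ψ)(v) = ψ(v + v_i e_j)`
   (`flat_sGate`, `flat_hGate`, `flat_cnot`).
2. **Quadratic functions** `IsQuad q` on `𝔽₂ⁿ`, abstractly: every directional derivative
   `x ↦ q(x + y) + q(x)` is affine (PSV22 Def. 2.7 and the remark after it — the only property of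
   quadratic polynomials the proof uses); closure under sums, products of linear/affine forms,
   linear substitutions and translations.
3. **Stabilizer functions** `IsStabFn F`: `F = c · 𝟙_{u+W} · i^{ℓ} · (-1)^{q}` with `W` a subspace,
   `ℓ` linear, `q` quadratic (PSV22 §2.1, eq. (1); Dehaene–De Moor 2003, Van den Nest 2010), and the
   **structure theorem** `isStabFn_flat_of_mem`: every state of `stabilizerStates n` is a stabilizer
   function — by `Submonoid.closure_induction` over the Clifford word, with an `S`-step, a
   `CNOT`-step (a linear involution of `𝔽₂ⁿ`) and an `H`-step (`IsStabFn.hStep`, three cases: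
   `e_j ∈ W` with `ℓ(e_j) = 0` — the support is cut by an affine hyperplane, possibly to `∅`;
   `e_j ∈ W` with `ℓ(e_j) = 1` — a `(1 ± i)` recombination; `e_j ∉ W` — the support doubles to
   `u + (W ⊕ ⟨e_j⟩)`, its two sheets told apart by a functional `g ⊥ W`, `g(e_j) = 1`
   (`Submodule.exists_le_ker_of_notMem`, PSV22 Fact 2.3)). The pointwise bookkeeping of each case
   is a closed identity in the bits involved, checked by exhausting `𝔽₂`.
4. **Counting in `𝔽₂ⁿ`** (all dimensions are handled as cardinalities `cntS W = |W|`): one linear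
   constraint at most halves a subspace (`cntS_le_two_mul`, PSV22 Fact 2.4), `r` constraints cost
   `2^r` (`cntS_le_pow_mul`); the average-fibre pigeonhole `exists_fiber_ge`; the Hamming-ball
   bound `|{v : |v| ≤ k}| · 3ⁿ ≤ 4ⁿ · 3ᵏ` (`card_ball_mul_le`, from `Σ_v 3^{n-|v|} = 4ⁿ`) which
   replaces Kleitman's diameter theorem (PSV22 Thm. 2.2) at the price of the constants; the
   numerical inequality `2ⁿ 2^{4r} 3^{8r} < 3ⁿ` for `100 r ≤ n`, `n ≥ 1` (`key_numeric`); and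
   PSV22 Cor. 2.6 in counted form (`exists_mem_weight_le`: a coset of a subspace with `≥ 2^{n-k}`
   points contains a vector of weight `≤ k` — minimal-weight element plus a kernel-by-counting
   argument instead of the rank argument of Claim 2.5).
5. **PSV22 Lemma 3.1** (`exists_hammingNorm_ne_of_isStabFn`): for `100 r ≤ n`, `1 ≤ n`, any `r`
   stabilizer functions agree (`φ_j(y) = φ_j(z)` for all `j`) at two points of different weight.
   Claim 3.3 (`V₁ = ⋂ ker ℓ_j`, the most popular support pattern, separation of the missed `A_j`,
   `|U₀| ≥ 2^{n-3r}`), Claim 3.4 (the most popular value pattern of the `q_j` on `U`, a pair at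
   distance `> 8r` by the ball bound, hence a heavy `v ∈ U₀` with `Δ_v q_j = 0` solvable on `U`),
   the solution coset (`|W'| ≥ 2^{n-4r}`), a light solution `y` (`|y| ≤ 4r`) and `z = y + v`
   (`|z| > 4r`).
6. **Transfer and conclusion.** `hadLayer n = H^{⊗n}` is Clifford and `H^{⊗n} ψ^{⊗n} = (Hψ)^{⊗n}`;
   Clifford circuits do not increase `χ` (`stabilizerRank_mulVec_le`), so
   `χ(|T⟩^{⊗n}) ≥ χ((H|T⟩)^{⊗n})`; `(H|T⟩)^{⊗n}(v) = ((1+ω)/2)^{n-|v|} ((1-ω)/2)^{|v|}` takes different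
   values on different Hamming layers since `0 < |1-ω| < |1+ω|` (`hammingNorm_eq_of_flat_eq`; this is
   the role of `|H⟩^{⊗n}`, Clifford-equivalent to `|T⟩^{⊗n}` up to the phase `e^{iπn/8}`, in the printed
   proof of Thm. 3.2 — the phase gate is not needed); an optimal decomposition of `(H|T⟩)^{⊗n}` with
   `100 χ ≤ n` terms would contradict Lemma 3.1. Hence `n < 100 χ(|T⟩^{⊗n})` for all `n ≥ 1`.

## References

* S. Peleg, A. Shpilka, B. L. Volk, *Lower bounds on stabilizer rank*, Quantum 6 (2022) 652,
  arXiv:2106.03214 [PelegShpilkaVolk2022]: §1.3 eq. (1), §2 (Def. 2.1, Thm. 2.2, Facts 2.3–2.4,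
  Claim 2.5, Cor. 2.6, Def. 2.7), §3 (Lemma 3.1, Thm. 3.2, Claims 3.3–3.4) — read from the held text
  (`lit read arxiv:2106.03214`, pp. 4–9).
* J. Dehaene, B. De Moor, *Clifford group, stabilizer states, and linear and quadratic operations
  over GF(2)*, Phys. Rev. A 68 (2003) 042318, Thm. 1; M. Van den Nest, *Classical simulation of
  quantum computation, the Gottesman–Knill theorem, and slightly beyond*, QIC 10 (2010) 258, §3
  (stabilizer states as quadratic forms on affine subspaces; here re-derived from the gate actions).
* M. A. Nielsen, I. L. Chuang, *Quantum Computation and Quantum Information*, CUP 2010, §4.2–4.3.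

## Design notes

* Constants: the paper's `r ≤ n/100` is kept; Kleitman's bound (sets of diameter `2n/3`) is replaced
  by containment in a Hamming ball of radius `8r` around any point, which `key_numeric` absorbs.
* No new named facts: every auxiliary statement is proved here (D-0026); the only imports beyond
  the fact file are the tree's stabilizer-formalism files and Mathlib's Hamming distance and
  vector-space duality.
-/

noncomputable section

namespace Literature.Computability.QuantumComplexity

open _root_.Computability Cryptography Matrix StabilizerFormalism

namespace PelegShpilkaVolk

open scoped Classical

/-! ### Bits: `𝔽₂ = ZMod 2`, signs and powers of `i` -/

/-- Bit vectors `𝔽₂ⁿ` as a `ZMod 2`-vector space. [folklore] -/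
abbrev BVec (n : ℕ) : Type := Fin n → ZMod 2

/-- Every element of `𝔽₂` is `0` or `1`. [folklore] -/
theorem zmod2_cases : ∀ a : ZMod 2, a = 0 ∨ a = 1 := by decide

/-- `1 + 1 = 0` in `𝔽₂`. [folklore] -/
@[simp] theorem zmod2_one_add_one : (1 + 1 : ZMod 2) = 0 := by decide

/-- In `𝔽₂`, `a ≠ 0 ↔ a = 1`. [folklore] -/
theorem zmod2_ne_zero_iff (a : ZMod 2) : a ≠ 0 ↔ a = 1 := by
  rcases zmod2_cases a with rfl | rfl <;> simp

/-- In `𝔽₂`, `a + b = 0 ↔ a = b`. [folklore] -/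
theorem zmod2_add_eq_zero_iff (a b : ZMod 2) : a + b = 0 ↔ a = b := by
  rcases zmod2_cases a with rfl | rfl <;> rcases zmod2_cases b with rfl | rfl <;> simp

/-- The sign `(-1)^a` of a bit `a ∈ 𝔽₂`. [folklore] -/
def sgnZ (a : ZMod 2) : ℂ := if a = 0 then 1 else -1

/-- The phase `i^a` of a bit `a ∈ 𝔽₂` (`a` read in `{0,1}`). [folklore] -/
def iPowZ (a : ZMod 2) : ℂ := if a = 0 then 1 else Complex.I

/-- `(-1)^0 = 1`. [folklore] -/
@[simp] theorem sgnZ_zero : sgnZ 0 = 1 := by simp [sgnZ]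
/-- `(-1)^1 = -1`. [folklore] -/
@[simp] theorem sgnZ_one : sgnZ 1 = -1 := by simp [sgnZ]
/-- `i^0 = 1`. [folklore] -/
@[simp] theorem iPowZ_zero : iPowZ 0 = 1 := by simp [iPowZ]
/-- `i^1 = i`. [folklore] -/
@[simp] theorem iPowZ_one : iPowZ 1 = Complex.I := by simp [iPowZ]

/-- `(-1)^{a+b} = (-1)^a (-1)^b`. [folklore] -/
theorem sgnZ_add (a b : ZMod 2) : sgnZ (a + b) = sgnZ a * sgnZ b := by
  rcases zmod2_cases a with rfl | rfl <;> rcases zmod2_cases b with rfl | rfl <;> simp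

/-- The parity identity `i^{[a ⊕ b]} = i^{[a]} i^{[b]} (-1)^{[a][b]}`. [folklore] -/
theorem iPowZ_add (a b : ZMod 2) : iPowZ (a + b) = iPowZ a * iPowZ b * sgnZ (a * b) := by
  rcases zmod2_cases a with rfl | rfl <;> rcases zmod2_cases b with rfl | rfl <;> simp

/-- `(-1)^a ≠ 0`. [folklore] -/
theorem sgnZ_ne_zero (a : ZMod 2) : sgnZ a ≠ 0 := by
  rcases zmod2_cases a with rfl | rfl <;> simp

/-- `i^a ≠ 0`. [folklore] -/
theorem iPowZ_ne_zero (a : ZMod 2) : iPowZ a ≠ 0 := by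
  rcases zmod2_cases a with rfl | rfl <;> simp [Complex.I_ne_zero]

/-- `((-1)^a)² = 1`. [folklore] -/
theorem sgnZ_mul_self (a : ZMod 2) : sgnZ a * sgnZ a = 1 := by
  rcases zmod2_cases a with rfl | rfl <;> simp

/-! ### Transport between the tree's Boolean registers and `𝔽₂ⁿ` -/

section transport

variable {n : ℕ}

/-- A bit vector as a Boolean register. [folklore] -/
def toQ (v : BVec n) : QReg n := fun i => decide (v i = 1)

/-- A Boolean register as a bit vector. [folklore] -/
def toB (x : QReg n) : BVec n := fun i => if x i then 1 else 0

/-- `toQ v i = true ↔ v i = 1`. [folklore] -/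
@[simp] theorem toQ_apply_eq_true (v : BVec n) (i : Fin n) : (toQ v i = true) ↔ v i = 1 := by
  simp [toQ]

/-- `toQ ∘ toB = id`. [folklore] -/
@[simp] theorem toQ_toB (x : QReg n) : toQ (toB x) = x := by
  funext i
  rcases Bool.eq_false_or_eq_true (x i) with h | h <;> simp [toQ, toB, h]

/-- `toB ∘ toQ = id`. [folklore] -/
@[simp] theorem toB_toQ (v : BVec n) : toB (toQ v) = v := by
  funext i
  rcases zmod2_cases (v i) with h | h <;> simp [toQ, toB, h]

/-- `toQ v = 0…0 ↔ v = 0`. [folklore] -/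
theorem toQ_eq_zero_iff (v : BVec n) : (toQ v = fun _ => false) ↔ v = 0 := by
  constructor
  · intro h
    funext i
    have hi := congrFun h i
    rcases zmod2_cases (v i) with h0 | h1
    · exact h0
    · simp [toQ, h1] at hi
  · rintro rfl
    funext i
    simp [toQ]

/-- Adding the unit vector `e_j` flips bit `j`. [folklore] -/
theorem toQ_add_single (v : BVec n) (j : Fin n) :
    toQ (v + Pi.single j 1) = bxor (toQ v) (Pi.single j true) := by
  funext i
  by_cases hij : i = j
  · subst hij
    rcases zmod2_cases (v i) with h | h <;> simp [toQ, h]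
  · simp [toQ, hij]

/-- A state vector read as a function on `𝔽₂ⁿ`. [folklore] -/
def flat (ψ : QReg n → ℂ) : BVec n → ℂ := fun v => ψ (toQ v)

/-- Definitional unfolding of `flat`. [folklore] -/
theorem flat_apply (ψ : QReg n → ℂ) (v : BVec n) : flat ψ v = ψ (toQ v) := rfl

/-- `flat` respects linear combinations. [folklore] -/
theorem flat_sum_smul {r : ℕ} (c : Fin r → ℂ) (φ : Fin r → QReg n → ℂ) (v : BVec n) :
    flat (∑ i, c i • φ i) v = ∑ i, c i * flat (φ i) v := by
  simp [flat, Finset.sum_apply]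

/-- The vacuum: `flat |0ⁿ⟩ = [v = 0]`. [folklore] -/
theorem flat_zeroState (v : BVec n) : flat (zeroState n) v = if v = 0 then 1 else 0 := by
  rw [flat_apply, zeroState, basisState_apply]
  by_cases hv : v = 0
  · rw [if_pos ((toQ_eq_zero_iff v).2 hv), if_pos hv]
  · rw [if_neg (fun h => hv ((toQ_eq_zero_iff v).1 h)), if_neg hv]

/-- **Action of `S_j`**: `(S_j ψ)(v) = i^{v_j} ψ(v)`. [Nielsen–Chuang 2010, §4.2] [folklore] -/
theorem flat_sGate (j : Fin n) (ψ : QReg n → ℂ) (v : BVec n) :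
    flat (placeGate (wireEmb j) sGate *ᵥ ψ) v = iPowZ (v j) * flat ψ v := by
  rw [flat_apply, placeGate_sGate_eq_pauli, Matrix.add_mulVec, Matrix.smul_mulVec, Matrix.smul_mulVec,
    Matrix.one_mulVec]
  simp only [Pi.add_apply, Pi.smul_apply, smul_eq_mul, pauliOp_mulVec_apply, bxor_zero, sgn_single_left,
    flat_apply]
  rcases zmod2_cases (v j) with h | h
  · have hb : toQ v j = false := by simp [toQ, h]
    simp only [hb, Bool.false_eq_true, if_false, h, iPowZ_zero]
    ring
  · have hb : toQ v j = true := by simp [toQ, h]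
    simp only [hb, if_true, h, iPowZ_one]
    ring

/-- **Action of `H_j`**: `(H_j ψ)(v) = (ψ(v + e_j) + (-1)^{v_j} ψ(v))/√2`.
[Nielsen–Chuang 2010, §4.2] [folklore] -/
theorem flat_hGate (j : Fin n) (ψ : QReg n → ℂ) (v : BVec n) :
    flat (placeGate (wireEmb j) hGate *ᵥ ψ) v =
      invSqrt2 * (flat ψ (v + Pi.single j 1) + sgnZ (v j) * flat ψ v) := by
  rw [flat_apply, placeGate_hGate_eq_pauli, Matrix.smul_mulVec, Matrix.add_mulVec]
  simp only [Pi.add_apply, Pi.smul_apply, smul_eq_mul, pauliOp_mulVec_apply, bxor_zero, sgn_single_left,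
    sgn_zero_left, one_mul, flat_apply, toQ_add_single]
  rcases zmod2_cases (v j) with h | h
  · have hb : toQ v j = false := by simp [toQ, h]
    simp [hb, h]
  · have hb : toQ v j = true := by simp [toQ, h]
    simp [hb, h]

/-- **Action of `CNOT_{i→j}`**: `(CNOT ψ)(v) = ψ(v + v_i e_j)`. [Nielsen–Chuang 2010, §4.3] [folklore] -/
theorem flat_cnot (i j : Fin n) (h : i ≠ j) (ψ : QReg n → ℂ) (v : BVec n) :
    flat (placeGate (pairEmb i j h) cnot *ᵥ ψ) v =
      if v i = 0 then flat ψ v else flat ψ (v + Pi.single j 1) := by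
  rw [flat_apply, placeGate_cnot_eq_pauli, Matrix.smul_mulVec, Matrix.sub_mulVec, Matrix.add_mulVec,
    Matrix.add_mulVec, Matrix.one_mulVec]
  simp only [Pi.smul_apply, Pi.sub_apply, Pi.add_apply, smul_eq_mul, pauliOp_mulVec_apply, bxor_zero,
    sgn_single_left, sgn_zero_left, one_mul, flat_apply, toQ_add_single, bxor_apply]
  have hji : (Pi.single j true : QReg n) i = false := by
    rw [Pi.single_eq_of_ne h]
    rfl
  simp only [hji, Bool.xor_false]
  rcases zmod2_cases (v i) with h0 | h1
  · have hb : toQ v i = false := by simp [toQ, h0]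
    simp only [hb, Bool.false_eq_true, if_false, h0, if_true]
    ring
  · have hb : toQ v i = true := by simp [toQ, h1]
    simp only [hb, if_true, h1, one_ne_zero, if_false]
    ring

end transport

/-! ### Quadratic functions on `𝔽₂ⁿ` (abstractly: all directional derivatives are affine) -/

section quad

variable {n : ℕ}

/-- `q : 𝔽₂ⁿ → 𝔽₂` is *quadratic* if every directional derivative `x ↦ q(x+y) + q(x)` is an affine
function (PSV22, Def. 2.7 and the observation following it). [cite: PelegShpilkaVolk2022, Def. 2.7] -/
def IsQuad (q : BVec n → ZMod 2) : Prop :=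
  ∀ y : BVec n, ∃ (a : BVec n →ₗ[ZMod 2] ZMod 2) (b : ZMod 2), ∀ x, q (x + y) = q x + a x + b

/-- Constants are quadratic. [folklore] -/
theorem IsQuad.const (b : ZMod 2) : IsQuad (fun _ : BVec n => b) :=
  fun _ => ⟨0, 0, fun x => by simp⟩

/-- Linear functions are quadratic. [folklore] -/
theorem IsQuad.linear (ℓ : BVec n →ₗ[ZMod 2] ZMod 2) : IsQuad (fun x => ℓ x) :=
  fun y => ⟨0, ℓ y, fun x => by simp⟩

/-- Sums of quadratic functions are quadratic. [folklore] -/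
theorem IsQuad.add {q q' : BVec n → ZMod 2} (hq : IsQuad q) (hq' : IsQuad q') :
    IsQuad (fun x => q x + q' x) := by
  intro y
  obtain ⟨a, b, hab⟩ := hq y
  obtain ⟨a', b', hab'⟩ := hq' y
  refine ⟨a + a', b + b', fun x => ?_⟩
  simp only [hab, hab', LinearMap.add_apply]
  ring

/-- Products of a linear and an affine function are quadratic. [folklore] -/
theorem IsQuad.mul_affine (ℓ m : BVec n →ₗ[ZMod 2] ZMod 2) (b : ZMod 2) :
    IsQuad (fun x => ℓ x * (m x + b)) := by
  intro y
  refine ⟨m y • ℓ + (ℓ y) • m, ℓ y * (m y + b), fun x => ?_⟩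
  simp only [map_add, LinearMap.add_apply, LinearMap.smul_apply, smul_eq_mul]
  ring

/-- Products of two linear functions are quadratic. [folklore] -/
theorem IsQuad.mul_linear (ℓ m : BVec n →ₗ[ZMod 2] ZMod 2) : IsQuad (fun x => ℓ x * m x) := by
  have h := IsQuad.mul_affine ℓ m 0
  simpa using h

/-- Scalar multiples of quadratic functions are quadratic. [folklore] -/
theorem IsQuad.smul {q : BVec n → ZMod 2} (c : ZMod 2) (hq : IsQuad q) : IsQuad (fun x => c * q x) := by
  intro y
  obtain ⟨a, b, hab⟩ := hq y
  refine ⟨c • a, c * b, fun x => ?_⟩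
  simp only [hab, LinearMap.smul_apply, smul_eq_mul]
  ring

/-- Quadratic functions are stable under linear substitutions. [folklore] -/
theorem IsQuad.comp {m : ℕ} {q : BVec n → ZMod 2} (hq : IsQuad q) (T : BVec m →ₗ[ZMod 2] BVec n) :
    IsQuad (fun x => q (T x)) := by
  intro y
  obtain ⟨a, b, hab⟩ := hq (T y)
  refine ⟨a.comp T, b, fun x => ?_⟩
  simp only [map_add, hab, LinearMap.comp_apply]

/-- Quadratic functions are stable under translations. [folklore] -/
theorem IsQuad.shift {q : BVec n → ZMod 2} (hq : IsQuad q) (t : BVec n) : IsQuad (fun x => q (x + t)) := by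
  intro y
  obtain ⟨a, b, hab⟩ := hq y
  refine ⟨a, b + a t, fun x => ?_⟩
  dsimp only
  rw [add_right_comm, hab, map_add]
  ring

end quad

/-! ### Stabilizer functions -/

section stabfn

variable {n : ℕ}

/-- `F : 𝔽₂ⁿ → ℂ` is a (scaled) **stabilizer function**: `F = c · 𝟙_{u+W} · i^{ℓ} · (-1)^{q}` with
`W` a linear subspace, `ℓ` linear and `q` quadratic (PSV22 §2.1; Dehaene–De Moor 2003, Van den Nest
2010). [cite: PelegShpilkaVolk2022, §2.1] -/
def IsStabFn (F : BVec n → ℂ) : Prop :=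
  ∃ (c : ℂ) (W : Submodule (ZMod 2) (BVec n)) (u : BVec n) (ℓ : BVec n →ₗ[ZMod 2] ZMod 2)
    (q : BVec n → ZMod 2), IsQuad q ∧
      ∀ v, F v = c * (if v + u ∈ W then 1 else 0) * iPowZ (ℓ v) * sgnZ (q v)

/-- The vacuum `[v = 0]` is a stabilizer function. [folklore] -/
theorem isStabFn_vacuum : IsStabFn (fun v : BVec n => if v = 0 then (1 : ℂ) else 0) := by
  refine ⟨1, ⊥, 0, 0, fun _ => 0, IsQuad.const 0, fun v => ?_⟩
  simp [Submodule.mem_bot]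

/-- **`S`-step**: `i^{v_j} F` is a stabilizer function if `F` is
(`i^{ℓ} i^{x_j} = i^{ℓ ⊕ x_j} (-1)^{ℓ x_j}`). [cite: PelegShpilkaVolk2022, §2.1] -/
theorem IsStabFn.sStep {F : BVec n → ℂ} (hF : IsStabFn F) (j : Fin n) :
    IsStabFn (fun v => iPowZ (v j) * F v) := by
  obtain ⟨c, W, u, ℓ, q, hq, hF⟩ := hF
  refine ⟨c, W, u, ℓ + LinearMap.proj j, fun x => q x + ℓ x * (LinearMap.proj (R := ZMod 2) j x),
    hq.add (IsQuad.mul_linear ℓ _), fun v => ?_⟩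
  dsimp only
  rw [hF v, LinearMap.add_apply, iPowZ_add, sgnZ_add]
  simp only [LinearMap.coe_proj, Function.eval]
  have h1 := sgnZ_mul_self (ℓ v * v j)
  linear_combination (-(c * (if v + u ∈ W then (1 : ℂ) else 0) * iPowZ (ℓ v) * sgnZ (q v) * iPowZ (v j))) * h1

/-- Composition with a linear involution preserves stabilizer functions. [folklore] -/
theorem IsStabFn.compInvol {F : BVec n → ℂ} (hF : IsStabFn F) (T : BVec n →ₗ[ZMod 2] BVec n)
    (hT : ∀ v, T (T v) = v) : IsStabFn (fun v => F (T v)) := by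
  obtain ⟨c, W, u, ℓ, q, hq, hF⟩ := hF
  refine ⟨c, W.comap T, T u, ℓ.comp T, fun x => q (T x), hq.comp T, fun v => ?_⟩
  dsimp only
  rw [hF (T v)]
  have hmem : (T v + u ∈ W) ↔ (v + T u ∈ W.comap T) := by
    rw [Submodule.mem_comap, map_add, hT]
  simp only [hmem, LinearMap.comp_apply]

/-- **`CNOT`-step**: `v ↦ F(v + v_i e_j)` is a stabilizer function if `F` is (a linear involution
of `𝔽₂ⁿ`). [cite: PelegShpilkaVolk2022, §2.1] -/
theorem IsStabFn.cnotStep {F : BVec n → ℂ} (hF : IsStabFn F) {i j : Fin n} (h : i ≠ j) :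
    IsStabFn (fun v => if v i = 0 then F v else F (v + Pi.single j 1)) := by
  let T : BVec n →ₗ[ZMod 2] BVec n :=
    LinearMap.id + (LinearMap.proj i).smulRight (Pi.single j (1 : ZMod 2))
  have hT : ∀ v, T v = v + v i • Pi.single j (1 : ZMod 2) := fun v => rfl
  have hTT : ∀ v, T (T v) = v := by
    intro v
    rw [hT, hT]
    have hji : (Pi.single j (1 : ZMod 2) : BVec n) i = 0 := Pi.single_eq_of_ne h _
    simp only [Pi.add_apply, Pi.smul_apply, hji, smul_eq_mul, mul_zero, add_zero]
    rw [add_assoc, ← two_smul (ZMod 2)]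
    have h2 : (2 : ZMod 2) = 0 := by decide
    rw [h2, zero_smul, add_zero]
  have key := hF.compInvol T hTT
  refine (show (fun v => if v i = 0 then F v else F (v + Pi.single j 1)) = fun v => F (T v) from ?_) ▸ key
  funext v
  rw [hT]
  rcases zmod2_cases (v i) with h0 | h1
  · simp [h0]
  · simp [h1]

/-- Pointwise identity behind the `H`-step, free case, `λ = 0`. [folklore] -/
theorem hStep_id_free0 (L Q M b X : ZMod 2) :
    iPowZ L * sgnZ (Q + M + b) + sgnZ X * (iPowZ L * sgnZ Q) =
      2 * (if M + b + X = 0 then 1 else 0) * iPowZ L * sgnZ (Q + X) := by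
  rcases zmod2_cases L with rfl | rfl <;> rcases zmod2_cases Q with rfl | rfl <;>
  rcases zmod2_cases M with rfl | rfl <;> rcases zmod2_cases b with rfl | rfl <;>
  rcases zmod2_cases X with rfl | rfl <;> simp <;> norm_num [Complex.ext_iff]

/-- Pointwise identity behind the `H`-step, free case, `λ = 1`. [folklore] -/
theorem hStep_id_free1 (L Q M b X : ZMod 2) :
    iPowZ (L + 1) * sgnZ (Q + M + b) + sgnZ X * (iPowZ L * sgnZ Q) =
      (1 + Complex.I) * iPowZ b * iPowZ (M + X) *
        sgnZ (Q + X + (L + M + b + X) + L * (L + M + b + X) + b * (M + X)) := by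
  rcases zmod2_cases L with rfl | rfl <;> rcases zmod2_cases Q with rfl | rfl <;>
  rcases zmod2_cases M with rfl | rfl <;> rcases zmod2_cases b with rfl | rfl <;>
  rcases zmod2_cases X with rfl | rfl <;> simp <;> norm_num [Complex.ext_iff]

/-- Pointwise identity behind the `H`-step, determined case, on `u + W`. [folklore] -/
theorem hStep_id_det0 (L Q X t : ZMod 2) :
    sgnZ X * (iPowZ L * sgnZ Q) = iPowZ t * iPowZ (L + t) * sgnZ (Q + X + t * t + L * t) := by
  rcases zmod2_cases L with rfl | rfl <;> rcases zmod2_cases Q with rfl | rfl <;>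
  rcases zmod2_cases X with rfl | rfl <;> rcases zmod2_cases t with rfl | rfl <;> simp

/-- Pointwise identity behind the `H`-step, determined case, on `u + e + W`. [folklore] -/
theorem hStep_id_det1 (L R lam γ : ZMod 2) :
    iPowZ (L + lam) * sgnZ R =
      iPowZ (lam * γ) * iPowZ (L + lam * (γ + 1)) *
        sgnZ (R + lam * L + lam * (γ + 1) * (lam * γ) + L * (lam * (γ + 1))) := by
  rcases zmod2_cases L with rfl | rfl <;> rcases zmod2_cases R with rfl | rfl <;>
  rcases zmod2_cases lam with rfl | rfl <;> rcases zmod2_cases γ with rfl | rfl <;> simp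

/-- Transport of quadraticity along a pointwise equality. [folklore] -/
theorem IsQuad.of_eq {q q' : BVec n → ZMod 2} (hq : IsQuad q) (h : ∀ x, q' x = q x) : IsQuad q' := by
  intro y
  obtain ⟨a, b, hab⟩ := hq y
  exact ⟨a, b, fun x => by rw [h, h, hab]⟩

/-- Affine functions are quadratic. [folklore] -/
theorem IsQuad.affine (m : BVec n →ₗ[ZMod 2] ZMod 2) (b : ZMod 2) : IsQuad (fun x => m x + b) :=
  (IsQuad.linear m).add (IsQuad.const b)

/-- `x + x = 0` in `𝔽₂ⁿ`. [folklore] -/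
theorem bvec_add_self (x : BVec n) : x + x = 0 := by
  funext i
  rcases zmod2_cases (x i) with h | h <;> simp [h]

/-- `(x + d) + (y + d) = x + y` in `𝔽₂ⁿ`. [folklore] -/
theorem bvec_add_add_add_cancel (x y d : BVec n) : (x + d) + (y + d) = x + y := by
  rw [add_add_add_comm, bvec_add_self, add_zero]

/-- Two translates of a subspace by points of the same coset coincide. [folklore] -/
theorem coset_mem_iff (W : Submodule (ZMod 2) (BVec n)) {v₀ u : BVec n} (h : v₀ + u ∈ W)
    (v : BVec n) : v + v₀ ∈ W ↔ v + u ∈ W := by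
  constructor
  · intro hv
    have := W.add_mem hv h
    rwa [add_assoc, ← add_assoc v₀, bvec_add_self, zero_add] at this
  · intro hv
    have := W.add_mem hv h
    rwa [bvec_add_add_add_cancel] at this

/-- Over `𝔽₂`, `W ⊔ ⟨e⟩ = W ∪ (e + W)`. [folklore] -/
theorem mem_sup_span_singleton_iff (W : Submodule (ZMod 2) (BVec n)) (e x : BVec n) :
    x ∈ W ⊔ (ZMod 2 ∙ e) ↔ (x ∈ W ∨ x + e ∈ W) := by
  constructor
  · intro hx
    rw [Submodule.mem_sup] at hx
    obtain ⟨w, hw, z, hz, rfl⟩ := hx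
    rw [Submodule.mem_span_singleton] at hz
    obtain ⟨t, rfl⟩ := hz
    rcases zmod2_cases t with rfl | rfl
    · left
      simpa using hw
    · right
      rwa [one_smul, add_assoc, bvec_add_self, add_zero]
  · rintro (hx | hx)
    · exact Submodule.mem_sup_left hx
    · have h2 : x = (x + e) + e := by rw [add_assoc, bvec_add_self, add_zero]
      rw [h2]
      exact Submodule.add_mem _ (Submodule.mem_sup_left hx)
        (Submodule.mem_sup_right (Submodule.mem_span_singleton_self e))

/-- `𝔽₂`-identity used in the determined case on `u + W`. [folklore] -/
theorem zq_det0 : ∀ (Q X L A b lam γ : ZMod 2),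
    Q + (γ * (lam * L + A + b) + γ * (lam * L + A + b)) + (X + γ * X + γ * X) +
        lam * γ * lam * γ + L * (lam * γ) =
      Q + X + lam * γ * (lam * γ) + L * (lam * γ) := by
  decide

/-- `𝔽₂`-identity used in the determined case on `u + e + W`. [folklore] -/
theorem zq_det1 : ∀ (Q X L A b lam γ : ZMod 2),
    Q + ((γ + 1) * (lam * L + A + b) + γ * (lam * L + A + b)) + (X + (γ + 1) * X + γ * X) +
        lam * γ * lam * (γ + 1) + L * (lam * (γ + 1)) =
      Q + A + b + lam * L + lam * (γ + 1) * (lam * γ) + L * (lam * (γ + 1)) := by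
  decide

/-- **`H`-step**: `v ↦ (F(v + e_j) + (-1)^{v_j} F(v))/√2` is a stabilizer function if `F` is.
Three cases: `e_j ∈ W` with `ℓ(e_j) = 0` (the support shrinks to an affine hyperplane section,
possibly empty), `e_j ∈ W` with `ℓ(e_j) = 1` (a `(1 ± i)` recombination), and `e_j ∉ W` (the support
doubles to `u + (W ⊕ ⟨e_j⟩)`, the two sheets told apart by a linear functional `g ⊥ W`, `g(e_j) = 1`).
[cite: PelegShpilkaVolk2022, §2.1] -/
theorem IsStabFn.hStep {F : BVec n → ℂ} (hF : IsStabFn F) (j : Fin n) :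
    IsStabFn (fun v => invSqrt2 * (F (v + Pi.single j 1) + sgnZ (v j) * F v)) := by
  obtain ⟨c, W, u, ℓ, q, hq, hF⟩ := hF
  set e : BVec n := Pi.single j 1 with he
  let p : BVec n →ₗ[ZMod 2] ZMod 2 := LinearMap.proj j
  have hp : ∀ x, p x = x j := fun x => rfl
  obtain ⟨a, b, hab⟩ := hq e
  have hFe : ∀ v, F (v + e) =
      c * (if v + u + e ∈ W then 1 else 0) * iPowZ (ℓ v + ℓ e) * sgnZ (q v + a v + b) := by
    intro v
    rw [hF (v + e), map_add, hab, add_right_comm]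
  by_cases heW : e ∈ W
  · -- free case: the support is a union of lines parallel to `e`
    have hmem : ∀ v, (v + u + e ∈ W) ↔ (v + u ∈ W) := fun v =>
      ⟨fun h => by simpa [add_assoc, bvec_add_self] using W.add_mem h heW, fun h => W.add_mem h heW⟩
    rcases zmod2_cases (ℓ e) with hl | hl
    · -- `λ = 0`
      by_cases hne : ∃ v₀, v₀ + u ∈ W ∧ a v₀ + v₀ j = b
      · obtain ⟨v₀, hv₀W, hv₀⟩ := hne
        refine ⟨invSqrt2 * c * 2, W ⊓ LinearMap.ker (a + p), v₀, ℓ,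
          fun x => q x + x j, hq.add (IsQuad.linear (p)), fun v => ?_⟩
        dsimp only
        rw [hFe v, hF v, hl, add_zero, if_congr (hmem v) rfl rfl]
        have key := hStep_id_free0 (ℓ v) (q v) (a v) b (v j)
        have hker : (v + v₀ ∈ W ⊓ LinearMap.ker (a + p)) ↔
            (v + u ∈ W ∧ a v + b + v j = 0) := by
          rw [Submodule.mem_inf, coset_mem_iff W hv₀W, LinearMap.mem_ker]
          have h2 : (a + p) (v + v₀) = a v + b + v j := by
            simp only [map_add, LinearMap.add_apply, hp]
            rw [← hv₀]
            ring
          rw [h2]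
        have hind : (if v + v₀ ∈ W ⊓ LinearMap.ker (a + p) then (1 : ℂ) else 0) =
            (if v + u ∈ W then 1 else 0) * (if a v + b + v j = 0 then 1 else 0) := by
          rw [if_congr hker rfl rfl]
          by_cases h1 : v + u ∈ W <;> by_cases h2 : a v + b + v j = 0 <;> simp [h1, h2]
        rw [hind]
        linear_combination (invSqrt2 * c * (if v + u ∈ W then 1 else 0)) * key
      · -- empty support: the new function vanishes
        refine ⟨0, ⊥, 0, 0, fun _ => 0, IsQuad.const 0, fun v => ?_⟩
        dsimp only
        rw [hFe v, hF v, hl, add_zero, if_congr (hmem v) rfl rfl]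
        have key := hStep_id_free0 (ℓ v) (q v) (a v) b (v j)
        have hzero : (if v + u ∈ W then (1 : ℂ) else 0) * (if a v + b + v j = 0 then (1 : ℂ) else 0) = 0 := by
          by_cases h1 : v + u ∈ W
          · have h2 : ¬ (a v + b + v j = 0) := by
              intro h2
              refine hne ⟨v, h1, ?_⟩
              have h3 : a v + v j + b = 0 := by rw [← h2]; ring
              exact (zmod2_add_eq_zero_iff _ _).1 h3
            simp [h2]
          · simp [h1]
        linear_combination (invSqrt2 * c * (if v + u ∈ W then 1 else 0)) * key +
          (invSqrt2 * c * 2 * iPowZ (ℓ v) * sgnZ (q v + v j)) * hzero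
    · -- `λ = 1`
      let m : BVec n →ₗ[ZMod 2] ZMod 2 := ℓ + a + p
      have hm : ∀ x, m x = ℓ x + a x + x j := fun x => rfl
      have hQ : IsQuad (fun x => q x + x j + (m x + b) + ℓ x * (m x + b) + b * ((a + p) x)) :=
        (((hq.add (IsQuad.linear (p))).add (IsQuad.affine m b)).add
          (IsQuad.mul_affine ℓ m b)).add ((IsQuad.linear _).smul b)
      refine ⟨invSqrt2 * c * (1 + Complex.I) * iPowZ b, W, u, a + p,
        fun x => q x + x j + (ℓ x + a x + b + x j) + ℓ x * (ℓ x + a x + b + x j) + b * (a x + x j),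
        hQ.of_eq (fun x => by simp only [hm, LinearMap.add_apply, hp]; ring),
        fun v => ?_⟩
      dsimp only
      rw [hFe v, hF v, hl, if_congr (hmem v) rfl rfl]
      simp only [LinearMap.add_apply, hp]
      have key := hStep_id_free1 (ℓ v) (q v) (a v) b (v j)
      linear_combination (invSqrt2 * c * (if v + u ∈ W then 1 else 0)) * key
  · -- determined case: `e ∉ W`; separate `e` from `W` by a functional `g`
    obtain ⟨g, hge, hgW⟩ := Submodule.exists_le_ker_of_notMem heW
    have hge1 : g e = 1 := (zmod2_ne_zero_iff _).1 hge
    have hg0 : ∀ w ∈ W, g w = 0 := fun w hw => LinearMap.mem_ker.1 (hgW hw)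
    set γ : ZMod 2 := g u with hγ
    set lam : ZMod 2 := ℓ e with hlam
    let m : BVec n →ₗ[ZMod 2] ZMod 2 := lam • ℓ + a
    have hm : ∀ x, m x = lam * ℓ x + a x := fun x => rfl
    have hQ : IsQuad (fun x => q x + (g x * (m x + b) + γ * (m x + b)) +
        (x j + g x * x j + γ * x j) + lam * γ * lam * g x + ℓ x * ((lam • g) x)) :=
      (((hq.add ((IsQuad.mul_affine g m b).add ((IsQuad.affine m b).smul γ))).add
        (((IsQuad.linear (p)).add (IsQuad.mul_linear g (p))).add
          ((IsQuad.linear (p)).smul γ))).add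
        ((IsQuad.linear g).smul _)).add (IsQuad.mul_linear ℓ (lam • g))
    refine ⟨invSqrt2 * c * iPowZ (lam * γ), W ⊔ (ZMod 2 ∙ e), u, ℓ + lam • g,
      fun x => q x + (g x * (lam * ℓ x + a x + b) + γ * (lam * ℓ x + a x + b)) +
        (x j + g x * x j + γ * x j) + lam * γ * lam * g x + ℓ x * (lam * g x),
      hQ.of_eq (fun x => by simp only [hm, LinearMap.smul_apply, smul_eq_mul]),
      fun v => ?_⟩
    dsimp only
    rw [hFe v, hF v, if_congr (mem_sup_span_singleton_iff W e (v + u)) rfl rfl]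
    simp only [LinearMap.add_apply, LinearMap.smul_apply, smul_eq_mul]
    by_cases h0 : v + u ∈ W
    · -- on the sheet `u + W`
      have h1 : ¬ (v + u + e ∈ W) := by
        intro h1
        apply heW
        have := W.add_mem h1 h0
        rwa [add_comm (v + u) e, add_assoc, bvec_add_self, add_zero] at this
      have hg : g v = γ := by
        have := hg0 _ h0
        rw [map_add] at this
        exact (zmod2_add_eq_zero_iff _ _).1 this
      rw [if_pos h0, if_neg h1, if_pos (Or.inl h0), hg, zq_det0]
      have key := hStep_id_det0 (ℓ v) (q v) (v j) (lam * γ)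
      linear_combination (invSqrt2 * c) * key
    · by_cases h1 : v + u + e ∈ W
      · -- on the sheet `u + e + W`
        have hg : g v = γ + 1 := by
          have := hg0 _ h1
          rw [map_add, map_add, hge1, add_assoc] at this
          exact (zmod2_add_eq_zero_iff _ _).1 this
        rw [if_neg h0, if_pos h1, if_pos (Or.inr h1), hg, zq_det1]
        have key := hStep_id_det1 (ℓ v) (q v + a v + b) lam γ
        linear_combination (invSqrt2 * c) * key
      · -- off the support
        have h2 : ¬ (v + u ∈ W ∨ v + u + e ∈ W) := by tauto
        rw [if_neg h0, if_neg h1, if_neg h2]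
        ring

/-! ### The structure theorem -/

/-- **Stabilizer states are stabilizer functions** (Dehaene–De Moor 2003, Thm. 1; Van den Nest
2010, §3; the representation PSV22 eq. (1) relies on): every state in the Clifford orbit of `|0ⁿ⟩`
is, as a function on `𝔽₂ⁿ`, of the form `c · 𝟙_{u+W} · i^{ℓ(x)} · (-1)^{q(x)}`. Proof by induction
over the Clifford word (`H`, `S`, `CNOT` steps above). [cite: PelegShpilkaVolk2022, §1.3 eq. (1) and §2.1] -/
theorem isStabFn_flat_of_mem {ψ : QReg n → ℂ} (hψ : ψ ∈ stabilizerStates n) : IsStabFn (flat ψ) := by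
  obtain ⟨C, hC, rfl⟩ := hψ
  suffices h : ∀ φ : QReg n → ℂ, IsStabFn (flat φ) → IsStabFn (flat (C *ᵥ φ)) by
    refine h _ ?_
    have e0 : flat (zeroState n) = fun v => if v = 0 then (1 : ℂ) else 0 := funext flat_zeroState
    rw [e0]
    exact isStabFn_vacuum
  unfold cliffordCircuits at hC
  induction hC using Submonoid.closure_induction with
  | mem M hM =>
    intro φ hφ
    rcases mem_placements_clifford_cases hM with ⟨j, rfl⟩ | ⟨j, rfl⟩ | ⟨i, j, hij, rfl⟩
    · have e1 : flat (placeGate (wireEmb j) hGate *ᵥ φ) =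
          fun v => invSqrt2 * (flat φ (v + Pi.single j 1) + sgnZ (v j) * flat φ v) :=
        funext (flat_hGate j φ)
      rw [e1]
      exact hφ.hStep j
    · have e1 : flat (placeGate (wireEmb j) sGate *ᵥ φ) = fun v => iPowZ (v j) * flat φ v :=
        funext (flat_sGate j φ)
      rw [e1]
      exact hφ.sStep j
    · have e1 : flat (placeGate (pairEmb i j hij) cnot *ᵥ φ) =
          fun v => if v i = 0 then flat φ v else flat φ (v + Pi.single j 1) :=
        funext (flat_cnot i j hij φ)
      rw [e1]
      exact hφ.cnotStep hij
  | one => intro φ hφ; simpa using hφ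
  | mul M M' _ _ ihM ihM' =>
    intro φ hφ
    rw [← Matrix.mulVec_mulVec]
    exact ihM _ (ihM' _ hφ)

end stabfn

/-! ### Counting in `𝔽₂ⁿ`: subspaces cut out by functionals, pigeonhole, Hamming balls -/

section counting

variable {n : ℕ}

/-- The number of points of a subspace of `𝔽₂ⁿ`. [folklore] -/
def cntS (W : Submodule (ZMod 2) (BVec n)) : ℕ := (Finset.univ.filter (fun v : BVec n => v ∈ W)).card

/-- `|𝔽₂ⁿ| = 2ⁿ`. [folklore] -/
theorem cntS_top : cntS (⊤ : Submodule (ZMod 2) (BVec n)) = 2 ^ n := by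
  simp [cntS, ZMod.card]

/-- A subspace is nonempty: `cntS W ≥ 1`. [folklore] -/
theorem one_le_cntS (W : Submodule (ZMod 2) (BVec n)) : 1 ≤ cntS W :=
  Finset.card_pos.2 ⟨0, by simp [W.zero_mem]⟩

/-- The intersection of a list of subspaces. [folklore] -/
def infList : List (Submodule (ZMod 2) (BVec n)) → Submodule (ZMod 2) (BVec n)
  | [] => ⊤
  | S :: L => S ⊓ infList L

/-- Membership in `infList`. [folklore] -/
theorem mem_infList {L : List (Submodule (ZMod 2) (BVec n))} {v : BVec n} :
    v ∈ infList L ↔ ∀ S ∈ L, v ∈ S := by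
  induction L with
  | nil => simp [infList]
  | cons S L ih => simp [infList, Submodule.mem_inf, ih]

/-- **Fact 2.4 / "one affine constraint costs one dimension"**, counted: cutting a subspace by the
kernel of one functional at most halves it. [cite: PelegShpilkaVolk2022, Fact 2.4] -/
theorem cntS_le_two_mul (W : Submodule (ZMod 2) (BVec n)) (f : BVec n →ₗ[ZMod 2] ZMod 2) :
    cntS W ≤ 2 * cntS (W ⊓ LinearMap.ker f) := by
  set A : Finset (BVec n) := Finset.univ.filter (fun v : BVec n => v ∈ W) with hA
  set A0 : Finset (BVec n) := A.filter (fun v => f v = 0) with hA0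
  set A1 : Finset (BVec n) := A.filter (fun v => ¬ f v = 0) with hA1
  have hsplit : A0.card + A1.card = A.card := Finset.card_filter_add_card_filter_not _
  have hA0' : A0 = Finset.univ.filter (fun v : BVec n => v ∈ W ⊓ LinearMap.ker f) := by
    ext v
    simp [hA0, hA, Submodule.mem_inf, LinearMap.mem_ker]
  have hle : A1.card ≤ A0.card := by
    rcases A1.eq_empty_or_nonempty with h1 | ⟨w₁, hw₁⟩
    · simp [h1]
    · have hw₁' : w₁ ∈ W ∧ f w₁ = 1 := by
        simp only [hA1, hA, Finset.mem_filter, Finset.mem_univ, true_and] at hw₁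
        exact ⟨hw₁.1, (zmod2_ne_zero_iff _).1 hw₁.2⟩
      refine Finset.card_le_card_of_injOn (fun v => v + w₁) ?_ ?_
      · intro v hv
        rw [Finset.mem_coe] at hv ⊢
        simp only [hA1, hA0, hA, Finset.mem_filter, Finset.mem_univ, true_and] at hv ⊢
        refine ⟨W.add_mem hv.1 hw₁'.1, ?_⟩
        rw [map_add, hw₁'.2, (zmod2_ne_zero_iff _).1 hv.2, zmod2_one_add_one]
      · intro v _ v' _ h
        exact add_right_cancel h
  unfold cntS
  rw [← hA0', ← hA]
  omega

/-- Iterated halving: `r` functionals cost at most a factor `2^r`. [cite: PelegShpilkaVolk2022, Fact 2.4] -/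
theorem cntS_le_pow_mul (W : Submodule (ZMod 2) (BVec n)) (L : List (BVec n →ₗ[ZMod 2] ZMod 2)) :
    cntS W ≤ 2 ^ L.length * cntS (W ⊓ infList (L.map LinearMap.ker)) := by
  induction L generalizing W with
  | nil => simp [infList]
  | cons f L ih =>
    calc cntS W ≤ 2 * cntS (W ⊓ LinearMap.ker f) := cntS_le_two_mul W f
      _ ≤ 2 * (2 ^ L.length * cntS ((W ⊓ LinearMap.ker f) ⊓ infList (L.map LinearMap.ker))) :=
          Nat.mul_le_mul_left 2 (ih _)
      _ = 2 ^ (f :: L).length * cntS (W ⊓ infList ((f :: L).map LinearMap.ker)) := by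
          simp only [List.length_cons, List.map_cons, infList, pow_succ, inf_assoc]
          ring

/-- A translate of a finite set into a subspace is counted by the subspace. [folklore] -/
theorem card_le_cntS_of_translate (P : Finset (BVec n)) (W : Submodule (ZMod 2) (BVec n)) (x₀ : BVec n)
    (h : ∀ x ∈ P, x + x₀ ∈ W) : P.card ≤ cntS W := by
  refine Finset.card_le_card_of_injOn (fun x => x + x₀) ?_ ?_
  · intro x hx
    simpa using h x hx
  · intro x _ x' _ hxx
    exact add_right_cancel hxx

/-- **Pigeonhole (average fibre)**: some fibre of `f : s → t` has at least `|s|/|t|` points.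
[folklore] -/
theorem exists_fiber_ge {α β : Type*} [DecidableEq β] (s : Finset α) (t : Finset β) (ht : t.Nonempty)
    (f : α → β) (hf : ∀ a ∈ s, f a ∈ t) :
    ∃ y ∈ t, s.card ≤ t.card * (s.filter (fun a => f a = y)).card := by
  obtain ⟨y, hy, hmax⟩ := Finset.exists_max_image t (fun y => (s.filter (fun a => f a = y)).card) ht
  refine ⟨y, hy, ?_⟩
  rw [Finset.card_eq_sum_card_fiberwise (fun a ha => hf a ha)]
  exact (Finset.sum_le_card_nsmul _ _ _ (fun z hz => hmax z hz)).trans (by simp)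

/-- The Hamming weight counts the nonzero coordinates; the zero coordinates are the rest.
[folklore] -/
theorem card_filter_eq_zero_add_hammingNorm (v : BVec n) :
    (Finset.univ.filter (fun i => v i = 0)).card + hammingNorm v = n := by
  have h := Finset.card_filter_add_card_filter_not (s := (Finset.univ : Finset (Fin n))) (fun i => v i = 0)
  simp only [Finset.card_univ, Fintype.card_fin] at h
  simpa [hammingNorm] using h

/-- The generating identity `Σ_v 3^{n-|v|} = 4ⁿ` (`= ∏_i (3 + 1)`). [folklore] -/
theorem sum_three_pow_sub_hammingNorm : ∑ v : BVec n, (3 : ℕ) ^ (n - hammingNorm v) = 4 ^ n := by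
  have h1 : ∀ v : BVec n, (3 : ℕ) ^ (n - hammingNorm v) = ∏ i, (if v i = 0 then (3 : ℕ) else 1) := by
    intro v
    rw [Finset.prod_ite, Finset.prod_const, Finset.prod_const_one, mul_one]
    congr 1
    have := card_filter_eq_zero_add_hammingNorm v
    omega
  rw [Finset.sum_congr rfl (fun v _ => h1 v),
    ← Fintype.prod_sum (fun (_ : Fin n) (a : ZMod 2) => if a = 0 then (3 : ℕ) else 1)]
  have h2 : (∑ a : ZMod 2, if a = 0 then (3 : ℕ) else 1) = 4 := by decide
  simp only [h2, Finset.prod_const, Finset.card_univ, Fintype.card_fin]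

/-- **Hamming balls are exponentially small** (the crude bound replacing Kleitman's theorem,
PSV22 Thm. 2.2, in our rendering): `|{v : |v| ≤ k}| · 3ⁿ ≤ 4ⁿ · 3ᵏ` for `k ≤ n`
(from `Σ_v 3^{n-|v|} = 4ⁿ`). [folklore] -/
theorem card_ball_mul_le {k : ℕ} (hk : k ≤ n) :
    (Finset.univ.filter (fun v : BVec n => hammingNorm v ≤ k)).card * 3 ^ n ≤ 4 ^ n * 3 ^ k := by
  set B := Finset.univ.filter (fun v : BVec n => hammingNorm v ≤ k) with hB
  have hle : B.card * 3 ^ (n - k) ≤ 4 ^ n := by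
    have e1 : B.card * 3 ^ (n - k) = ∑ _v ∈ B, (3 : ℕ) ^ (n - k) := by
      rw [Finset.sum_const, smul_eq_mul]
    have h3 : ∑ _v ∈ B, (3 : ℕ) ^ (n - k) ≤ ∑ v ∈ B, (3 : ℕ) ^ (n - hammingNorm v) := by
      refine Finset.sum_le_sum fun v hv => ?_
      refine Nat.pow_le_pow_right (by norm_num) ?_
      have hv' : hammingNorm v ≤ k := by
        simp only [hB, Finset.mem_filter, Finset.mem_univ, true_and] at hv
        exact hv
      omega
    have h4 : ∑ v ∈ B, (3 : ℕ) ^ (n - hammingNorm v) ≤ ∑ v, (3 : ℕ) ^ (n - hammingNorm v) :=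
      Finset.sum_le_univ_sum_of_nonneg (fun _ => Nat.zero_le _)
    rw [e1, ← sum_three_pow_sub_hammingNorm]
    exact h3.trans h4
  calc B.card * 3 ^ n = B.card * 3 ^ (n - k) * 3 ^ k := by
        rw [mul_assoc, ← pow_add, Nat.sub_add_cancel hk]
    _ ≤ 4 ^ n * 3 ^ k := Nat.mul_le_mul_right _ hle

/-- The numerical heart of the constants: for `100 r ≤ n`, `1 ≤ n`:
`2ⁿ · 2^{4r} · 3^{8r} < 3ⁿ`. [folklore] -/
theorem key_numeric {r : ℕ} (hr : 100 * r ≤ n) (hn : 1 ≤ n) : 2 ^ n * 2 ^ (4 * r) * 3 ^ (8 * r) < 3 ^ n := by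
  have hK : 2 ^ (4 * r) * 3 ^ (8 * r) = 104976 ^ r := by
    rw [pow_mul, pow_mul, ← mul_pow]
    norm_num
  rw [mul_assoc, hK]
  rcases Nat.eq_zero_or_pos r with rfl | hr0
  · simp only [pow_zero, mul_one]
    exact Nat.pow_lt_pow_left (by norm_num) (by omega)
  · obtain ⟨s, rfl⟩ : ∃ s, n = 100 * r + s := ⟨n - 100 * r, by omega⟩
    have h1 : (2 : ℕ) ^ (100 * r + s) * 104976 ^ r = (2 ^ 100 * 104976) ^ r * 2 ^ s := by
      rw [pow_add, pow_mul, mul_pow]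
      ring
    have h2 : (3 : ℕ) ^ (100 * r + s) = (3 ^ 100) ^ r * 3 ^ s := by
      rw [pow_add, pow_mul]
    rw [h1, h2]
    have h3 : (2 ^ 100 * 104976 : ℕ) ^ r < (3 ^ 100) ^ r :=
      Nat.pow_lt_pow_left (by norm_num) (by omega)
    have h4 : (2 : ℕ) ^ s ≤ 3 ^ s := Nat.pow_le_pow_left (by norm_num) s
    calc (2 ^ 100 * 104976 : ℕ) ^ r * 2 ^ s < (3 ^ 100) ^ r * 2 ^ s :=
          Nat.mul_lt_mul_of_pos_right h3 (pow_pos (by norm_num) s)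
      _ ≤ (3 ^ 100) ^ r * 3 ^ s := Nat.mul_le_mul_left _ h4

/-- `-x = x` in `𝔽₂ⁿ`. [folklore] -/
theorem bvec_neg (x : BVec n) : -x = x := by
  rw [neg_eq_iff_add_eq_zero, bvec_add_self]

/-- In `𝔽₂ⁿ`, the weight of a sum is the Hamming distance. [folklore] -/
theorem hammingNorm_add (x y : BVec n) : hammingNorm (x + y) = hammingDist x y := by
  rw [hammingDist_eq_hammingNorm, bvec_neg]

/-- Triangle inequality for weights: `|v| ≤ |y + v| + |y|`. [folklore] -/
theorem hammingNorm_le_add (y v : BVec n) : hammingNorm v ≤ hammingNorm (y + v) + hammingNorm y := by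
  have h := hammingDist_triangle v (y + v) 0
  have e1 : v + (y + v) = y := by rw [add_left_comm, bvec_add_self, add_zero]
  rw [hammingDist_zero_right, hammingDist_zero_right, ← hammingNorm_add, e1] at h
  omega

/-- **Corollary 2.6 (counted form)**: a coset of a subspace with at least `2^{n-k}` points contains
a vector of weight `≤ k` (minimal-weight element; if its support `S` had more than `k` points, two
distinct elements of the subspace would agree off `S`, and their difference would shorten it).
[cite: PelegShpilkaVolk2022, Claim 2.5 and Cor. 2.6] -/
theorem exists_mem_weight_le (W : Submodule (ZMod 2) (BVec n)) (t : BVec n) (k : ℕ)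
    (h : 2 ^ n ≤ 2 ^ k * cntS W) : ∃ w ∈ W, hammingNorm (t + w) ≤ k := by
  set S : Finset (BVec n) := Finset.univ.filter (fun v : BVec n => v ∈ W) with hS
  have hSne : S.Nonempty := ⟨0, by simp [hS, W.zero_mem]⟩
  obtain ⟨w, hwS, hmin⟩ := Finset.exists_min_image S (fun w => hammingNorm (t + w)) hSne
  have hwW : w ∈ W := by simpa [hS] using hwS
  refine ⟨w, hwW, ?_⟩
  by_contra hlt
  push Not at hlt
  set y := t + w with hy
  -- the zero set `T` of `y` is small
  set T : Finset (Fin n) := Finset.univ.filter (fun i => y i = 0) with hT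
  have hTn : T.card + hammingNorm y = n := card_filter_eq_zero_add_hammingNorm y
  -- restriction to `T` is not injective on `W`
  let ρ : BVec n → ({i // y i = 0} → ZMod 2) := fun v i => v i.1
  have hcardT : Fintype.card ({i // y i = 0} → ZMod 2) = 2 ^ T.card := by
    rw [Fintype.card_fun, ZMod.card, Fintype.card_subtype]
  have hlt2 : (Finset.univ : Finset ({i // y i = 0} → ZMod 2)).card < S.card := by
    rw [Finset.card_univ, hcardT]
    have h1 : T.card + k + 1 ≤ n := by omega
    have h2 : 2 ^ T.card * 2 ^ (k + 1) ≤ 2 ^ k * S.card := by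
      calc 2 ^ T.card * 2 ^ (k + 1) = 2 ^ (T.card + k + 1) := by rw [← pow_add, add_assoc]
        _ ≤ 2 ^ n := Nat.pow_le_pow_right (by norm_num) h1
        _ ≤ 2 ^ k * S.card := h
    have h3 : 2 ^ k * (2 * 2 ^ T.card) ≤ 2 ^ k * S.card := by
      calc 2 ^ k * (2 * 2 ^ T.card) = 2 ^ T.card * 2 ^ (k + 1) := by ring
        _ ≤ 2 ^ k * S.card := h2
    have h4 : 2 * 2 ^ T.card ≤ S.card := Nat.le_of_mul_le_mul_left h3 (pow_pos (by norm_num) k)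
    have h5 : 1 ≤ 2 ^ T.card := Nat.one_le_two_pow
    omega
  obtain ⟨w₁, hw₁, w₂, hw₂, hne, heq⟩ :=
    Finset.exists_ne_map_eq_of_card_lt_of_maps_to hlt2 (f := ρ) (fun v _ => Finset.mem_univ _)
  have hw₁W : w₁ ∈ W := by simpa [hS] using hw₁
  have hw₂W : w₂ ∈ W := by simpa [hS] using hw₂
  set d := w₁ + w₂ with hd
  have hdW : d ∈ W := W.add_mem hw₁W hw₂W
  have hd0 : d ≠ 0 := by
    intro h0
    apply hne
    have : w₁ = w₁ + w₂ + w₂ := by rw [add_assoc, bvec_add_self, add_zero]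
    rw [this, ← hd, h0, zero_add]
  have hdT : ∀ i, y i = 0 → d i = 0 := by
    intro i hi
    have := congrFun heq ⟨i, hi⟩
    simp only [ρ] at this
    rw [hd, Pi.add_apply, this, ← two_mul]
    have h2 : (2 : ZMod 2) = 0 := by decide
    rw [h2, zero_mul]
  -- `y + d` has strictly smaller support
  have hsub : (Finset.univ.filter (fun i => (y + d) i ≠ 0)) ⊂ (Finset.univ.filter (fun i => y i ≠ 0)) := by
    rw [Finset.ssubset_iff_of_subset]
    · obtain ⟨i₀, hi₀⟩ : ∃ i₀, d i₀ ≠ 0 := by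
        by_contra hall
        push Not at hall
        exact hd0 (funext hall)
      refine ⟨i₀, ?_, ?_⟩
      · simp only [Finset.mem_filter, Finset.mem_univ, true_and]
        intro hy0
        exact hi₀ (hdT i₀ hy0)
      · simp only [Finset.mem_filter, Finset.mem_univ, true_and, Pi.add_apply, not_not]
        have hy1 : y i₀ = 1 := by
          rcases zmod2_cases (y i₀) with h0 | h1
          · exact absurd (hdT i₀ h0) hi₀
          · exact h1
        rw [hy1, (zmod2_ne_zero_iff _).1 hi₀, zmod2_one_add_one]
    · intro i
      simp only [Finset.mem_filter, Finset.mem_univ, true_and, Pi.add_apply]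
      intro hi hy0
      rw [hy0, hdT i hy0, add_zero] at hi
      exact hi rfl
  have hlt3 : hammingNorm (y + d) < hammingNorm y := Finset.card_lt_card hsub
  have hmin' := hmin (w + d) (by simp [hS, W.add_mem hwW hdW])
  rw [← add_assoc, ← hy] at hmin'
  omega

/-- Membership in the intersection of a `Fin`-indexed family. [folklore] -/
theorem mem_infList_ofFn {r : ℕ} (T : Fin r → Submodule (ZMod 2) (BVec n)) (v : BVec n) :
    v ∈ infList (List.ofFn T) ↔ ∀ j, v ∈ T j := by
  rw [mem_infList, List.forall_mem_ofFn_iff]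

/-- Membership in the joint kernel of a `Fin`-indexed family of functionals. [folklore] -/
theorem mem_infList_ker_ofFn {r : ℕ} (f : Fin r → BVec n →ₗ[ZMod 2] ZMod 2) (v : BVec n) :
    v ∈ infList ((List.ofFn f).map LinearMap.ker) ↔ ∀ j, f j v = 0 := by
  rw [List.map_ofFn, mem_infList_ofFn]
  simp [LinearMap.mem_ker]

end counting

/-! ### Lemma 3.1 of PSV22: few stabilizer functions agree on two different Hamming layers -/

section mainLemma

variable {n : ℕ}

/-- **PSV22, Lemma 3.1** (with explicit constants): if `100 r ≤ n` and `1 ≤ n`, then any `r`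
stabilizer functions `φ_j` on `𝔽₂ⁿ` take pairwise-equal values `φ_j(y) = φ_j(z)` at two points
`y, z` of *different* Hamming weight; hence so does every `F = Σ_j c_j φ_j` of stabilizer rank `≤ r`.
Proof as printed (Claims 3.3, 3.4, Cor. 2.6), with Kleitman's theorem replaced by the crude
Hamming-ball bound `card_ball_mul_le` (radius `8r`): `|y| ≤ 4r < |z|`.
[cite: PelegShpilkaVolk2022, Lemma 3.1 with Claims 3.3–3.4] -/
theorem exists_hammingNorm_ne_of_isStabFn {r : ℕ} (hrn : 100 * r ≤ n) (hn : 1 ≤ n)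
    (φ : Fin r → BVec n → ℂ) (hφ : ∀ j, IsStabFn (φ j)) :
    ∃ y z : BVec n, hammingNorm y ≠ hammingNorm z ∧ ∀ j, φ j y = φ j z := by
  choose c W u ℓ q hq hφ using hφ
  have h2pos : ∀ m : ℕ, 0 < 2 ^ m := fun m => pow_pos (by norm_num) m
  -- Claim 3.3, step 1: the joint kernel `V₁` of the linear parts
  set V₁ : Submodule (ZMod 2) (BVec n) := infList ((List.ofFn ℓ).map LinearMap.ker) with hV₁
  have hV₁mem : ∀ v, v ∈ V₁ ↔ ∀ j, ℓ j v = 0 := fun v => mem_infList_ker_ofFn ℓ v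
  have hV₁cnt : 2 ^ n ≤ 2 ^ r * cntS V₁ := by
    have := cntS_le_pow_mul ⊤ (List.ofFn ℓ)
    rwa [cntS_top, List.length_ofFn, top_inf_eq] at this
  -- Claim 3.3, step 2: the most popular support pattern `α` on `V₁`
  set S₁ : Finset (BVec n) := Finset.univ.filter (fun v : BVec n => v ∈ V₁) with hS₁
  set E : BVec n → (Fin r → Bool) := fun x j => decide (x + u j ∈ W j) with hE
  obtain ⟨α, -, hα⟩ := exists_fiber_ge S₁ (Finset.univ : Finset (Fin r → Bool)) Finset.univ_nonempty E
    (fun _ _ => Finset.mem_univ _)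
  set P₁ : Finset (BVec n) := S₁.filter (fun x => E x = α) with hP₁
  have hP₁cnt : 2 ^ n ≤ 2 ^ r * (2 ^ r * P₁.card) := by
    have hc : (Finset.univ : Finset (Fin r → Bool)).card = 2 ^ r := by simp
    rw [hc] at hα
    exact hV₁cnt.trans (Nat.mul_le_mul_left _ hα)
  have hmemP₁ : ∀ x ∈ P₁, x ∈ V₁ ∧ E x = α := fun x hx => by simpa [hP₁, hS₁] using hx
  have hP₁ne : P₁.Nonempty := by
    rw [← Finset.card_pos]
    by_contra h0
    have h0' : P₁.card = 0 := by omega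
    rw [h0', mul_zero, mul_zero] at hP₁cnt
    exact absurd hP₁cnt (not_le.2 (h2pos n))
  obtain ⟨x₀, hx₀⟩ := hP₁ne
  have hx₀V : x₀ ∈ V₁ := (hmemP₁ x₀ hx₀).1
  have hx₀E : E x₀ = α := (hmemP₁ x₀ hx₀).2
  have hEiff : ∀ x j, E x = α → (x + u j ∈ W j ↔ α j = true) := by
    intro x j hx
    have := congrFun hx j
    simp only [hE] at this
    rw [← this, decide_eq_true_iff]
  -- Claim 3.3, step 3 (Fact 2.3): separate `x₀ + u_j` from `W_j` whenever `x₀ ∉ A_j`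
  have hsep : ∀ j, ∃ g : BVec n →ₗ[ZMod 2] ZMod 2,
      (α j = false → g (x₀ + u j) = 1 ∧ ∀ w ∈ W j, g w = 0) := by
    intro j
    by_cases hj : α j = false
    · have hnot : x₀ + u j ∉ W j := by
        rw [hEiff x₀ j hx₀E, hj]
        exact Bool.false_ne_true
      obtain ⟨g, hg1, hg2⟩ := Submodule.exists_le_ker_of_notMem hnot
      exact ⟨g, fun _ => ⟨(zmod2_ne_zero_iff _).1 hg1, fun w hw => LinearMap.mem_ker.1 (hg2 hw)⟩⟩
    · exact ⟨0, fun h => absurd h hj⟩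
  choose g hg using hsep
  set W₂ : Submodule (ZMod 2) (BVec n) :=
    V₁ ⊓ infList (List.ofFn (fun j => if α j = true then W j else ⊤)) with hW₂
  have hW₂mem : ∀ v, v ∈ W₂ ↔ (v ∈ V₁ ∧ ∀ j, α j = true → v ∈ W j) := by
    intro v
    rw [hW₂, Submodule.mem_inf, mem_infList_ofFn]
    refine and_congr Iff.rfl (forall_congr' fun j => ?_)
    by_cases hj : α j = true
    · simp [hj]
    · simp [hj]
  set U₀ : Submodule (ZMod 2) (BVec n) := W₂ ⊓ infList ((List.ofFn g).map LinearMap.ker) with hU₀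
  have hU₀mem : ∀ v, v ∈ U₀ ↔ (v ∈ W₂ ∧ ∀ j, g j v = 0) := by
    intro v
    rw [hU₀, Submodule.mem_inf, mem_infList_ker_ofFn]
  have hP₁W₂ : P₁.card ≤ cntS W₂ := by
    refine card_le_cntS_of_translate P₁ W₂ x₀ fun x hx => ?_
    obtain ⟨hxV, hxE⟩ := hmemP₁ x hx
    rw [hW₂mem]
    refine ⟨V₁.add_mem hxV hx₀V, fun j hj => ?_⟩
    have h1 : x + u j ∈ W j := (hEiff x j hxE).2 hj
    have h2 : x₀ + u j ∈ W j := (hEiff x₀ j hx₀E).2 hj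
    have := (W j).add_mem h1 h2
    rwa [bvec_add_add_add_cancel] at this
  have hU₀cnt : 2 ^ n ≤ 2 ^ (3 * r) * cntS U₀ := by
    have h1 : cntS W₂ ≤ 2 ^ r * cntS U₀ := by
      have := cntS_le_pow_mul W₂ (List.ofFn g)
      rwa [List.length_ofFn] at this
    calc 2 ^ n ≤ 2 ^ r * (2 ^ r * P₁.card) := hP₁cnt
      _ ≤ 2 ^ r * (2 ^ r * (2 ^ r * cntS U₀)) :=
          Nat.mul_le_mul_left _ (Nat.mul_le_mul_left _ (hP₁W₂.trans h1))
      _ = 2 ^ (3 * r) * cntS U₀ := by ring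
  -- the affine subspace `U = x₀ + U₀`: all `ℓ_j` and all indicators are constant on it
  have hUℓ : ∀ w ∈ U₀, ∀ j, ℓ j w = 0 := by
    intro w hw j
    exact (hV₁mem w).1 ((hW₂mem w).1 ((hU₀mem w).1 hw).1).1 j
  have hUind : ∀ w ∈ U₀, ∀ j, (x₀ + w + u j ∈ W j ↔ x₀ + u j ∈ W j) := by
    intro w hw j
    obtain ⟨hwW₂, hwg⟩ := (hU₀mem w).1 hw
    obtain ⟨-, hwW⟩ := (hW₂mem w).1 hwW₂
    have e1 : x₀ + w + u j = (x₀ + u j) + w := add_right_comm _ _ _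
    rw [e1]
    cases hj : α j
    · -- `x₀ ∉ A_j`: the functional `g_j` keeps the whole coset out of `A_j`
      obtain ⟨hg1, hg0⟩ := hg j hj
      have hout : x₀ + u j ∉ W j := fun h => by simpa [hg1] using hg0 _ h
      have hout' : x₀ + u j + w ∉ W j := fun h => by
        have := hg0 _ h
        rw [map_add, hg1, hwg j, add_zero] at this
        exact one_ne_zero this
      exact ⟨fun h => absurd h hout', fun h => absurd h hout⟩
    · have hin : x₀ + u j ∈ W j := (hEiff x₀ j hx₀E).2 hj
      exact ⟨fun _ => hin, fun _ => (W j).add_mem hin (hwW j hj)⟩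
  -- Claim 3.4: a heavy direction `v ∈ U₀` along which all `q_j` can be matched
  set S₂ : Finset (BVec n) := Finset.univ.filter (fun w : BVec n => w ∈ U₀) with hS₂
  set Γ : BVec n → (Fin r → ZMod 2) := fun w j => q j (x₀ + w) with hΓ
  obtain ⟨β, -, hβ⟩ := exists_fiber_ge S₂ (Finset.univ : Finset (Fin r → ZMod 2)) Finset.univ_nonempty Γ
    (fun _ _ => Finset.mem_univ _)
  set P₂ : Finset (BVec n) := S₂.filter (fun w => Γ w = β) with hP₂
  have hP₂cnt : 2 ^ n ≤ 2 ^ (4 * r) * P₂.card := by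
    have hc : (Finset.univ : Finset (Fin r → ZMod 2)).card = 2 ^ r := by simp [ZMod.card]
    rw [hc] at hβ
    calc 2 ^ n ≤ 2 ^ (3 * r) * cntS U₀ := hU₀cnt
      _ = 2 ^ (3 * r) * S₂.card := rfl
      _ ≤ 2 ^ (3 * r) * (2 ^ r * P₂.card) := Nat.mul_le_mul_left _ hβ
      _ = 2 ^ (4 * r) * P₂.card := by ring
  have hmemP₂ : ∀ w ∈ P₂, w ∈ U₀ ∧ Γ w = β := fun w hw => by simpa [hP₂, hS₂] using hw
  have hdiam : ∃ w₁ ∈ P₂, ∃ w₂ ∈ P₂, 8 * r < hammingNorm (w₁ + w₂) := by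
    by_contra hcon
    push Not at hcon
    have hP₂ne : P₂.Nonempty := by
      rw [← Finset.card_pos]
      by_contra h0
      have h0' : P₂.card = 0 := by omega
      rw [h0', mul_zero] at hP₂cnt
      exact absurd hP₂cnt (not_le.2 (h2pos n))
    obtain ⟨w₁, hw₁⟩ := hP₂ne
    have hsub : P₂.card ≤ (Finset.univ.filter (fun v : BVec n => hammingNorm v ≤ 8 * r)).card := by
      refine Finset.card_le_card_of_injOn (fun w => w + w₁) ?_ ?_
      · intro w hw
        rw [Finset.mem_coe] at hw ⊢
        simp only [Finset.mem_filter, Finset.mem_univ, true_and]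
        exact hcon w hw w₁ hw₁
      · intro w _ w' _ h
        exact add_right_cancel h
    have hball := card_ball_mul_le (n := n) (k := 8 * r) (by omega)
    have hnum := key_numeric hrn hn
    have h1 : 2 ^ n * 3 ^ n ≤ 2 ^ (4 * r) * (4 ^ n * 3 ^ (8 * r)) := by
      calc 2 ^ n * 3 ^ n ≤ 2 ^ (4 * r) * P₂.card * 3 ^ n := Nat.mul_le_mul_right _ hP₂cnt
        _ = 2 ^ (4 * r) * (P₂.card * 3 ^ n) := by ring
        _ ≤ 2 ^ (4 * r) * ((Finset.univ.filter (fun v : BVec n => hammingNorm v ≤ 8 * r)).card * 3 ^ n) :=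
            Nat.mul_le_mul_left _ (Nat.mul_le_mul_right _ hsub)
        _ ≤ 2 ^ (4 * r) * (4 ^ n * 3 ^ (8 * r)) := Nat.mul_le_mul_left _ hball
    have h4n : (4 : ℕ) ^ n = 2 ^ n * 2 ^ n := by
      rw [← mul_pow]
      norm_num
    rw [h4n] at h1
    have h2 : 2 ^ n * 3 ^ n ≤ 2 ^ n * (2 ^ n * 2 ^ (4 * r) * 3 ^ (8 * r)) := by
      calc 2 ^ n * 3 ^ n ≤ 2 ^ (4 * r) * (2 ^ n * 2 ^ n * 3 ^ (8 * r)) := h1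
        _ = 2 ^ n * (2 ^ n * 2 ^ (4 * r) * 3 ^ (8 * r)) := by ring
    have h3 : 3 ^ n ≤ 2 ^ n * 2 ^ (4 * r) * 3 ^ (8 * r) := Nat.le_of_mul_le_mul_left h2 (h2pos n)
    exact absurd hnum (not_lt.2 h3)
  obtain ⟨w₁, hw₁, w₂, hw₂, hv⟩ := hdiam
  set v : BVec n := w₁ + w₂ with hvdef
  have hw₁U : w₁ ∈ U₀ := (hmemP₂ w₁ hw₁).1
  have hw₂U : w₂ ∈ U₀ := (hmemP₂ w₂ hw₂).1
  have hvU : v ∈ U₀ := U₀.add_mem hw₁U hw₂U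
  set x₁ : BVec n := x₀ + w₁ with hx₁
  have hqx₁ : ∀ j, q j (x₁ + v) = q j x₁ := by
    intro j
    have e : x₁ + v = x₀ + w₂ := by
      rw [hx₁, hvdef, add_assoc, ← add_assoc w₁, bvec_add_self, zero_add]
    rw [e, hx₁]
    have h1 := congrFun (hmemP₂ w₁ hw₁).2 j
    have h2 := congrFun (hmemP₂ w₂ hw₂).2 j
    simp only [hΓ] at h1 h2
    rw [h1, h2]
  -- the derivative equations `Δ_v q_j = 0` on `U`: a coset `x₁ + W'` of solutions
  choose a b hab using fun j => hq j v
  have hab0 : ∀ j, a j x₁ + b j = 0 := by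
    intro j
    have := hab j x₁
    rw [hqx₁ j, add_assoc] at this
    simpa using this
  set W' : Submodule (ZMod 2) (BVec n) := U₀ ⊓ infList ((List.ofFn a).map LinearMap.ker) with hW'
  have hW'mem : ∀ w, w ∈ W' ↔ (w ∈ U₀ ∧ ∀ j, a j w = 0) := by
    intro w
    rw [hW', Submodule.mem_inf, mem_infList_ker_ofFn]
  have hW'cnt : 2 ^ n ≤ 2 ^ (4 * r) * cntS W' := by
    have h1 : cntS U₀ ≤ 2 ^ r * cntS W' := by
      have := cntS_le_pow_mul U₀ (List.ofFn a)
      rwa [List.length_ofFn] at this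
    calc 2 ^ n ≤ 2 ^ (3 * r) * cntS U₀ := hU₀cnt
      _ ≤ 2 ^ (3 * r) * (2 ^ r * cntS W') := Nat.mul_le_mul_left _ h1
      _ = 2 ^ (4 * r) * cntS W' := by ring
  -- Cor. 2.6: a light solution `y`; its heavy partner `z = y + v`
  obtain ⟨w, hwW', hwt⟩ := exists_mem_weight_le W' x₁ (4 * r) hW'cnt
  have hwU : w ∈ U₀ := ((hW'mem w).1 hwW').1
  have haw : ∀ j, a j w = 0 := ((hW'mem w).1 hwW').2
  refine ⟨x₁ + w, x₁ + w + v, ?_, fun j => ?_⟩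
  · have htri := hammingNorm_le_add (x₁ + w) v
    omega
  · have h1U : w₁ + w ∈ U₀ := U₀.add_mem hw₁U hwU
    have h2U : w₁ + w + v ∈ U₀ := U₀.add_mem h1U hvU
    have hyw : x₁ + w = x₀ + (w₁ + w) := by rw [hx₁, add_assoc]
    have hzw : x₁ + w + v = x₀ + (w₁ + w + v) := by rw [hyw, add_assoc]
    rw [hφ j (x₁ + w), hφ j (x₁ + w + v)]
    have hind : (x₁ + w + u j ∈ W j) ↔ (x₁ + w + v + u j ∈ W j) := by
      rw [hzw, hyw, hUind _ h1U j, hUind _ h2U j]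
    have hlin : ℓ j (x₁ + w + v) = ℓ j (x₁ + w) := by
      rw [map_add, hUℓ v hvU j, add_zero]
    have hquad : q j (x₁ + w + v) = q j (x₁ + w) := by
      rw [hab j (x₁ + w)]
      have : a j (x₁ + w) + b j = 0 := by
        rw [map_add, haw j, add_zero, hab0 j]
      rw [add_assoc, this, add_zero]
    rw [if_congr hind rfl rfl, hlin, hquad]

end mainLemma

/-! ### The Clifford transfer `|T⟩^{⊗n} ↦ H^{⊗n}|T⟩^{⊗n} = (H|T⟩)^{⊗n}` and the magic-state function -/

section transfer

/-- The Hadamard layer `H^{⊗n}`, built one wire at a time. [folklore] -/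
def hadLayer : (n : ℕ) → Matrix (QReg n) (QReg n) ℂ
  | 0 => 1
  | n + 1 => placeGate (Fin.castAddEmb 1) (hadLayer n) * placeGate (Fin.natAddEmb n) hGate

/-- `H^{⊗n}` is a Clifford circuit. [folklore] -/
theorem hadLayer_mem : ∀ n, hadLayer n ∈ cliffordCircuits n
  | 0 => by
    rw [hadLayer]
    exact Submonoid.one_mem _
  | n + 1 => by
    rw [hadLayer]
    exact Submonoid.mul_mem _ (placeGate_mem_cliffordCircuits _ (hadLayer_mem n))
      (placeGate_mem_cliffordCircuits _ hGate_mem_cliffordCircuits)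

/-- `H^{⊗n} ψ^{⊗n} = (Hψ)^{⊗n}`. [Nielsen–Chuang 2010, §2.1.7] [folklore] -/
theorem hadLayer_mulVec_tensorPow (ψ : QReg 1 → ℂ) :
    ∀ n, hadLayer n *ᵥ tensorPow ψ n = tensorPow (hGate *ᵥ ψ) n
  | 0 => by
    rw [hadLayer, Matrix.one_mulVec]
    rfl
  | n + 1 => by
    rw [hadLayer, tensorPow, tensorPow, ← Matrix.mulVec_mulVec, placeGate_natAddEmb_mulVec_tensorVec,
      placeGate_castAddEmb_mulVec_tensorVec, hadLayer_mulVec_tensorPow ψ n]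

/-- **Clifford circuits do not increase the stabilizer rank**: `χ(Cψ) ≤ χ(ψ)` (apply `C` to an
optimal decomposition). [cite: PelegShpilkaVolk2022, §1.2 (Clifford-equivalent states have equal rank)] -/
theorem stabilizerRank_mulVec_le {n : ℕ} {C : Matrix (QReg n) (QReg n) ℂ} (hC : C ∈ cliffordCircuits n)
    (ψ : QReg n → ℂ) : stabilizerRank (C *ᵥ ψ) ≤ stabilizerRank ψ := by
  obtain ⟨c, φ, hφ, hψ⟩ := exists_stabilizerDecomposition ψ
  have h := stabilizerRank_le_card (ψ := C *ᵥ ψ) c (fun i => C *ᵥ φ i)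
    (fun i => mulVec_mem_stabilizerStates hC (hφ i)) (by
      conv_lhs => rw [hψ]
      rw [Matrix.mulVec_sum]
      exact Finset.sum_congr rfl fun i _ => Matrix.mulVec_smul _ _ _)
  simpa using h

/-- A tensor power evaluates to the product of the one-wire amplitudes. [folklore] -/
theorem tensorPow_apply_prod (ψ : QReg 1 → ℂ) : ∀ (m : ℕ) (x : QReg m),
    tensorPow ψ m x = ∏ i, ψ (fun _ => x i)
  | 0, x => by simp [tensorPow]
  | m + 1, x => by
    rw [CliffordSim.tensorPow_succ_apply, Fin.prod_univ_castSucc, tensorPow_apply_prod ψ m]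
    rfl

/-- The action of the Hadamard matrix on a one-wire vector. [Nielsen–Chuang 2010, §1.3.1] [folklore] -/
theorem hGate_mulVec_apply (v : QReg 1 → ℂ) (x : QReg 1) :
    (hGate *ᵥ v) x = invSqrt2 * v (fun _ => false) + (if x 0 = true then -invSqrt2 else invSqrt2) * v (fun _ => true) := by
  simp only [Matrix.mulVec, dotProduct]
  rw [sum_qReg_one, Fintype.sum_bool, add_comm]
  congr 1
  · rw [hGate_apply_false x _ rfl]
  · simp [hGate]

/-- The two amplitudes of `H|T⟩`: `((1 + ω)/2, (1 - ω)/2)`. [folklore] -/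
theorem hGate_mulVec_magicT_apply (x : QReg 1) :
    (hGate *ᵥ magicT) x = if x 0 = true then (1 - omega) / 2 else (1 + omega) / 2 := by
  rw [hGate_mulVec_apply, CliffordSim.magicT_apply, CliffordSim.magicT_apply]
  have h2 : invSqrt2 * invSqrt2 = 1 / 2 := invSqrt2_mul_invSqrt2
  by_cases hx : x 0 = true
  · simp only [hx, if_true, Bool.false_eq_true, if_false]
    linear_combination (1 - omega) * h2
  · simp only [hx, if_true, Bool.false_eq_true, if_false]
    linear_combination (1 + omega) * h2

/-- `|1 - ω|² = 2 - √2`. [folklore] -/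
theorem norm_one_sub_omega_sq : ‖(1 - omega : ℂ)‖ ^ 2 = 2 - Real.sqrt 2 := by
  rw [Complex.sq_norm, Complex.normSq_apply, Complex.sub_re, Complex.one_re, omega_re,
    Complex.sub_im, Complex.one_im, omega_im]
  have hs : Real.sqrt 2 * Real.sqrt 2 = 2 := Real.mul_self_sqrt (by norm_num)
  linear_combination (1 / 2 : ℝ) * hs

/-- `0 < |1 - ω| < |1 + ω|` (i.e. `0 < tan(π/8) < 1`). [folklore] -/
theorem norm_one_sub_omega_pos_lt :
    0 < ‖(1 - omega : ℂ)‖ ∧ ‖(1 - omega : ℂ)‖ < ‖(1 + omega : ℂ)‖ := by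
  have hs0 : 0 < Real.sqrt 2 := Real.sqrt_pos.2 (by norm_num)
  have h1 : ‖(1 - omega : ℂ)‖ ^ 2 = 2 - Real.sqrt 2 := norm_one_sub_omega_sq
  have h2 : ‖(1 + omega : ℂ)‖ ^ 2 = 2 + Real.sqrt 2 := norm_one_add_omega_sq
  constructor
  · rw [norm_pos_iff]
    intro h
    have := congrArg Complex.im h
    rw [Complex.sub_im, Complex.one_im, omega_im, Complex.zero_im] at this
    linarith
  · have hlt : ‖(1 - omega : ℂ)‖ ^ 2 < ‖(1 + omega : ℂ)‖ ^ 2 := by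
      rw [h1, h2]
      linarith
    exact lt_of_pow_lt_pow_left₀ 2 (norm_nonneg _) hlt

end transfer

section final

variable {n : ℕ}

/-- **The transferred magic-state function** on `𝔽₂ⁿ`:
`(H|T⟩)^{⊗n}(v) = ((1+ω)/2)^{n-|v|} · ((1-ω)/2)^{|v|}` — a function of the Hamming weight alone,
as `F_H` in PSV22 Thm. 3.2 (`|H⟩ = e^{-iπ/8} S H|T⟩`; the phase gate `S` is not needed here).
[cite: PelegShpilkaVolk2022, Thm. 3.2 (proof)] -/
theorem flat_tensorPow_hGate_magicT (v : BVec n) :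
    flat (tensorPow (hGate *ᵥ magicT) n) v =
      ((1 + omega) / 2) ^ (n - hammingNorm v) * ((1 - omega) / 2) ^ hammingNorm v := by
  rw [flat_apply, tensorPow_apply_prod]
  have h1 : ∀ i, (hGate *ᵥ magicT) (fun _ => toQ v i) =
      if v i = 0 then (1 + omega) / 2 else (1 - omega) / 2 := by
    intro i
    rw [hGate_mulVec_magicT_apply]
    rcases zmod2_cases (v i) with h | h
    · have hb : toQ v i = false := by simp [toQ, h]
      simp [hb, h]
    · have hb : toQ v i = true := by simp [toQ, h]
      simp [hb, h]
  simp_rw [h1]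
  rw [Finset.prod_ite, Finset.prod_const, Finset.prod_const]
  have h2 := card_filter_eq_zero_add_hammingNorm v
  have h3 : (Finset.univ.filter (fun i => ¬ v i = 0)).card = hammingNorm v := by
    simp [hammingNorm]
  rw [h3]
  congr 2
  omega

/-- **`F(y) = F(z)` forces `|y| = |z|`** for the transferred magic-state function: its modulus
`|1+ω|^{n-k} |1-ω|^{k} / 2ⁿ` is strictly decreasing in the weight `k` because `0 < |1-ω| < |1+ω|`
("for every `y, z` of different Hamming weight those functions attain different values",
PSV22 proof of Thm. 3.2). [cite: PelegShpilkaVolk2022, Thm. 3.2 (proof)] -/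
theorem hammingNorm_eq_of_flat_eq {y z : BVec n}
    (h : flat (tensorPow (hGate *ᵥ magicT) n) y = flat (tensorPow (hGate *ᵥ magicT) n) z) :
    hammingNorm y = hammingNorm z := by
  rw [flat_tensorPow_hGate_magicT, flat_tensorPow_hGate_magicT] at h
  set A : ℝ := ‖((1 + omega) / 2 : ℂ)‖ with hA
  set B : ℝ := ‖((1 - omega) / 2 : ℂ)‖ with hB
  obtain ⟨hpos, hlt⟩ := norm_one_sub_omega_pos_lt
  have h2 : ‖(2 : ℂ)‖ = 2 := by simp
  have hB0 : 0 < B := by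
    rw [hB, norm_div, h2]
    exact div_pos hpos (by norm_num)
  have hBA : B < A := by
    rw [hA, hB, norm_div, norm_div, h2]
    exact div_lt_div_of_pos_right hlt (by norm_num)
  have hA0 : 0 < A := hB0.trans hBA
  have key : ∀ k, ‖((1 + omega) / 2 : ℂ) ^ (n - k) * ((1 - omega) / 2) ^ k‖ = A ^ (n - k) * B ^ k := by
    intro k
    rw [norm_mul, norm_pow, norm_pow]
  have hanti : ∀ k₁ k₂, k₁ < k₂ → k₂ ≤ n → A ^ (n - k₂) * B ^ k₂ < A ^ (n - k₁) * B ^ k₁ := by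
    intro k₁ k₂ hlt12 hk₂
    obtain ⟨m, hm, rfl⟩ : ∃ m, 0 < m ∧ k₂ = k₁ + m := ⟨k₂ - k₁, by omega, by omega⟩
    have e1 : n - k₁ = n - (k₁ + m) + m := by omega
    rw [e1, pow_add, pow_add]
    have hBm : B ^ m < A ^ m := pow_lt_pow_left₀ hBA hB0.le (by omega)
    have hpos' : 0 < A ^ (n - (k₁ + m)) * B ^ k₁ := by positivity
    calc A ^ (n - (k₁ + m)) * (B ^ k₁ * B ^ m) = (A ^ (n - (k₁ + m)) * B ^ k₁) * B ^ m := by ring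
      _ < (A ^ (n - (k₁ + m)) * B ^ k₁) * A ^ m := mul_lt_mul_of_pos_left hBm hpos'
      _ = A ^ (n - (k₁ + m)) * A ^ m * B ^ k₁ := by ring
  by_contra hne
  have hy : hammingNorm y ≤ n := by simpa using (hammingNorm_le_card_fintype (x := y))
  have hz : hammingNorm z ≤ n := by simpa using (hammingNorm_le_card_fintype (x := z))
  have hnorm := congrArg norm h
  rw [key, key] at hnorm
  rcases lt_or_gt_of_ne hne with hlt' | hgt'
  · exact absurd hnorm (ne_of_gt (hanti _ _ hlt' hz))
  · exact absurd hnorm.symm (ne_of_gt (hanti _ _ hgt' hy))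

end final

end PelegShpilkaVolk

open PelegShpilkaVolk in
/-- **Discharge of `PelegShpilkaVolk2022_stabilizerRank_magicT_linear`** (Peleg–Shpilka–Volk 2022,
Thm. 1.1 = Thm. 3.2: `χ(|T⟩^{⊗n}) = Ω(n)`), with the explicit constant `c = 1/100`, `n₀ = 0`:
for `n ≥ 1`, `χ(|T⟩^{⊗n}) ≥ χ(H^{⊗n}|T⟩^{⊗n})` (`stabilizerRank_mulVec_le`, `hadLayer`); an
optimal decomposition of `(H|T⟩)^{⊗n}` into `r` stabilizer states gives `r` stabilizer functions
on `𝔽₂ⁿ` (`isStabFn_flat_of_mem`, Dehaene–De Moor / Van den Nest); if `100 r ≤ n`, Lemma 3.1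
(`exists_hammingNorm_ne_of_isStabFn`) yields `y, z` of different weight on which all of them, hence
`(H|T⟩)^{⊗n}`, agree — contradicting `hammingNorm_eq_of_flat_eq`. So `100 χ > n`.
[cite: PelegShpilkaVolk2022, Thm. 1.1 (= Thm. 3.2) via Lemma 3.1] -/
theorem PelegShpilkaVolk2022_stabilizerRank_magicT_linear_holds :
    PelegShpilkaVolk2022_stabilizerRank_magicT_linear := by
  refine ⟨1 / 100, by norm_num, 0, fun n _ => ?_⟩
  rcases Nat.eq_zero_or_pos n with rfl | hn
  · simp
  · set G : QReg n → ℂ := tensorPow (hGate *ᵥ magicT) n with hGdef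
    have hG : stabilizerRank G ≤ stabilizerRank (tensorPow magicT n) := by
      rw [hGdef, ← hadLayer_mulVec_tensorPow]
      exact stabilizerRank_mulVec_le (hadLayer_mem n) _
    have hlow : n < 100 * stabilizerRank G := by
      by_contra hcon
      push Not at hcon
      obtain ⟨c, φ, hφ, hGdec⟩ := exists_stabilizerDecomposition G
      obtain ⟨y, z, hne, hyz⟩ := exists_hammingNorm_ne_of_isStabFn hcon hn (fun j => flat (φ j))
        (fun j => isStabFn_flat_of_mem (hφ j))
      apply hne
      apply hammingNorm_eq_of_flat_eq
      rw [← hGdef, hGdec, flat_sum_smul, flat_sum_smul]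
      exact Finset.sum_congr rfl fun j _ => by rw [hyz j]
    have h1 : n < 100 * stabilizerRank (tensorPow magicT n) :=
      hlow.trans_le (Nat.mul_le_mul_left 100 hG)
    have h2 : (n : ℝ) < 100 * (stabilizerRank (tensorPow magicT n) : ℝ) := by exact_mod_cast h1
    linarith

end Literature.Computability.QuantumComplexity
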